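import Summits.QuantumFields.YangMills.Theorems.CurvatureKernelBound.Negative.FreeKernel

/-!
# `CurvatureKernelBound` — negative lemmas, chain C I: exponential bound of the free kernel and Euler integrals

Supports crux item `stmt-QuantumFields-11687` (`PencilRigidity.CurvatureKernelBound`). Standing disprover's negative
lemmas (refuter, cdisprove cycle 3), chain C: the dimension-5 generalised free field through the generic admissible-kernel
pipeline, culminating in `GFF.not_axialGrowthOfEuclideanPackage` (even full `O(4)`-invariance on `⁰𝒮` and E2 in EVERY frame
do not bound the order of the two-point singularity). No conclusion below asserts a Theses statement positively.

`G_le_exp : G_m(x) ≤ e^{-m‖x‖/2}/(2π²‖x‖²)` (AM–GM `m²t + ‖x‖²/(8t) ≥ m‖x‖/2` under the subordination integral, then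
`∫ φ_{r/√2} = 1/(2π²r²)`), and the Euler integrals `eul n a r = ∫_{t>a} tⁿe^{-rt} dt`: `eul_le` (`≤ n!/r^{n+1}`), `eul_ge`
(`≥ e⁻²/r^{n+1}` for `a ≤ 1/r`), `eul_le_exp` (`≤ e^{a(1−r)} eul n a 1` for `r ≥ 1`), monotonicity. [folklore]
-/

open scoped BigOperators Topology SchwartzMap
open MeasureTheory Filter Set Real
open Literature.MathematicalPhysics.QuantumLattice Literature.MathematicalPhysics.AQFT
open Literature.Analysis.UnboundedOperators

noncomputable section

namespace Summit.QuantumFields.YangMills.Theorems.CurvatureKernelBound.Negative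

namespace GFF

open FreeKernel

/-- Exponential upper bound for the free kernel: `G_m(x) ≤ e^{-m‖x‖/2} / (2π²‖x‖²)` (`x ≠ 0`; any real `m`),
from `m²t + ‖x‖²/(8t) ≥ m‖x‖/2` (AM–GM) under the subordination integral. -/
theorem G_le_exp (m : ℝ) {x : E4} (hx : x ≠ 0) :
    G m x ≤ Real.exp (-(m * ‖x‖ / 2)) * (1 / (2 * π ^ 2 * ‖x‖ ^ 2)) := by
  set r := ‖x‖ with hr
  have hr0 : 0 < r := norm_pos_iff.2 hx
  have hr' : r / Real.sqrt 2 ≠ 0 := by positivity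
  -- pointwise: e^{-m²t} φ_r(t) ≤ e^{-mr/2} φ_{r/√2}(t)
  have hpt : ∀ t ∈ Ioi (0 : ℝ), Real.exp (-m ^ 2 * t) * φ r t ≤
      Real.exp (-(m * r / 2)) * φ (r / Real.sqrt 2) t := by
    intro t ht
    have ht0 : 0 < t := mem_Ioi.1 ht
    unfold φ
    have hsq : (r / Real.sqrt 2) ^ 2 = r ^ 2 / 2 := by
      rw [div_pow, Real.sq_sqrt (by norm_num : (0:ℝ) ≤ 2)]
    rw [hsq]
    have key : -m ^ 2 * t + -r ^ 2 / (4 * t) ≤ -(m * r / 2) + -(r ^ 2 / 2) / (4 * t) := by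
      -- m²t + r²/(8t) ≥ m r / 2
      have h8 : m * r / 2 ≤ m ^ 2 * t + r ^ 2 / (8 * t) := by
        rw [← sub_nonneg]
        have : m ^ 2 * t + r ^ 2 / (8 * t) - m * r / 2 =
            (8 * m ^ 2 * t ^ 2 + r ^ 2 - 4 * m * r * t) / (8 * t) := by
          field_simp
          ring
        rw [this]
        exact div_nonneg (by nlinarith [sq_nonneg (2 * m * t - r / 2)]) (by positivity)
      have e1 : -(r ^ 2 / 2) / (4 * t) = -(r ^ 2 / (8 * t)) := by
        field_simp
        ring
      have e2 : -r ^ 2 / (4 * t) = -(r ^ 2 / (8 * t)) - r ^ 2 / (8 * t) := by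
        field_simp
        ring
      rw [e1, e2]
      linarith
    calc Real.exp (-m ^ 2 * t) * (((4 * π * t) ^ 2)⁻¹ * Real.exp (-r ^ 2 / (4 * t)))
        = ((4 * π * t) ^ 2)⁻¹ * Real.exp (-m ^ 2 * t + -r ^ 2 / (4 * t)) := by
          rw [Real.exp_add]; ring
      _ ≤ ((4 * π * t) ^ 2)⁻¹ * Real.exp (-(m * r / 2) + -(r ^ 2 / 2) / (4 * t)) := by
          gcongr
      _ = Real.exp (-(m * r / 2)) * (((4 * π * t) ^ 2)⁻¹ * Real.exp (-(r ^ 2 / 2) / (4 * t))) := by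
          rw [Real.exp_add]; ring
  have hint : IntegrableOn (fun t => Real.exp (-(m * r / 2)) * φ (r / Real.sqrt 2) t) (Ioi 0) :=
    (integrableOn_φ_Ioi hr' le_rfl).const_mul _
  calc G m x = ∫ t in Ioi (0 : ℝ), Real.exp (-m ^ 2 * t) * φ r t := G_eq m x
    _ ≤ ∫ t in Ioi (0 : ℝ), Real.exp (-(m * r / 2)) * φ (r / Real.sqrt 2) t := by
        refine setIntegral_mono_on ?_ hint measurableSet_Ioi hpt
        refine hint.mono' ?_ ?_
        · exact ((Real.continuous_exp.comp (continuous_const.mul continuous_id)).aestronglyMeasurable).mul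
            (integrableOn_φ_Ioi hr0.ne' le_rfl).aestronglyMeasurable
        · refine (ae_restrict_iff' measurableSet_Ioi).2 (ae_of_all _ fun t ht => ?_)
          rw [Real.norm_of_nonneg (mul_nonneg (Real.exp_pos _).le (φ_nonneg _ _))]
          exact hpt t ht
    _ = Real.exp (-(m * r / 2)) * (1 / (4 * π ^ 2 * (r / Real.sqrt 2) ^ 2)) := by
        rw [integral_const_mul, integral_φ_Ioi hr' le_rfl, Φ_zero, sub_zero]
    _ = Real.exp (-(m * r / 2)) * (1 / (2 * π ^ 2 * r ^ 2)) := by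
        rw [div_pow, Real.sq_sqrt (by norm_num : (0:ℝ) ≤ 2)]
        congr 1
        field_simp
        ring


/-! ### Generic Euler integrals `eul n a r = ∫_{t>a} tⁿ e^{-rt} dt` -/

/-- `tⁿ e^{-rt}`. -/
def eint (n : ℕ) (r t : ℝ) : ℝ := t ^ n * Real.exp (-(r * t))

/-- `eul n a r = ∫_{t>a} tⁿ e^{-rt} dt`. -/
def eul (n : ℕ) (a r : ℝ) : ℝ := ∫ t in Ioi a, eint n r t

/-- Auxiliary fact `eint_nonneg` of the generalised-free-field witness (see the module docstring). [folklore] -/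
theorem eint_nonneg (n : ℕ) (r : ℝ) {t : ℝ} (ht : 0 ≤ t) : 0 ≤ eint n r t :=
  mul_nonneg (pow_nonneg ht n) (Real.exp_pos _).le

/-- Auxiliary fact `eint_eq_rpow` of the generalised-free-field witness (see the module docstring). [folklore] -/
theorem eint_eq_rpow (n : ℕ) (r t : ℝ) :
    eint n r t = t ^ (((n + 1 : ℕ) : ℝ) - 1) * Real.exp (-(r * t)) := by
  rw [eint, ← Real.rpow_natCast t n]
  push_cast
  ring_nf

/-- Auxiliary fact `continuous_eint_uncurry` of the generalised-free-field witness (see the module docstring). [folklore] -/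
theorem continuous_eint_uncurry (n : ℕ) : Continuous fun p : ℝ × ℝ => eint n p.1 p.2 := by
  unfold eint; fun_prop

/-- Auxiliary fact `continuous_eint` of the generalised-free-field witness (see the module docstring). [folklore] -/
theorem continuous_eint (n : ℕ) (r : ℝ) : Continuous (eint n r) := by
  unfold eint; fun_prop

/-- Auxiliary fact `integrableOn_eint_Ioi_zero` of the generalised-free-field witness (see the module docstring). [folklore] -/
theorem integrableOn_eint_Ioi_zero (n : ℕ) {r : ℝ} (hr : 0 < r) : IntegrableOn (eint n r) (Ioi 0) := by
  have hn : (0 : ℝ) < ((n + 1 : ℕ) : ℝ) := by positivity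
  have h : IntegrableOn (fun t : ℝ => t ^ (((n + 1 : ℕ) : ℝ) - 1) * Real.exp (-(r * t))) (Ioi 0) := by
    refine Integrable.of_integral_ne_zero ?_
    rw [Real.integral_rpow_mul_exp_neg_mul_Ioi hn hr]
    exact (mul_pos (by positivity) (Real.Gamma_pos_of_pos hn)).ne'
  exact h.congr_fun (fun t _ => (eint_eq_rpow n r t).symm) measurableSet_Ioi

/-- Auxiliary fact `integrableOn_eint` of the generalised-free-field witness (see the module docstring). [folklore] -/
theorem integrableOn_eint (n : ℕ) {a r : ℝ} (ha : 0 ≤ a) (hr : 0 < r) : IntegrableOn (eint n r) (Ioi a) :=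
  (integrableOn_eint_Ioi_zero n hr).mono_set (Ioi_subset_Ioi ha)

/-- Auxiliary fact `eul_nonneg` of the generalised-free-field witness (see the module docstring). [folklore] -/
theorem eul_nonneg (n : ℕ) {a : ℝ} (ha : 0 ≤ a) (r : ℝ) : 0 ≤ eul n a r :=
  setIntegral_nonneg measurableSet_Ioi fun _ ht => eint_nonneg n r (ha.trans (le_of_lt ht))

/-- `eul n a r ≤ n! / r^{n+1}` (the full Euler integral). -/
theorem eul_le (n : ℕ) {a r : ℝ} (ha : 0 ≤ a) (hr : 0 < r) :
    eul n a r ≤ Nat.factorial n * r⁻¹ ^ (n + 1) := by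
  have hn : (0 : ℝ) < ((n + 1 : ℕ) : ℝ) := by positivity
  calc eul n a r ≤ ∫ t in Ioi (0 : ℝ), eint n r t :=
        setIntegral_mono_set (integrableOn_eint_Ioi_zero n hr)
          (ae_restrict_of_forall_mem measurableSet_Ioi fun t ht => eint_nonneg n r (le_of_lt ht))
          (Eventually.of_forall (Ioi_subset_Ioi ha))
    _ = ∫ t in Ioi (0 : ℝ), t ^ (((n + 1 : ℕ) : ℝ) - 1) * Real.exp (-(r * t)) :=
        setIntegral_congr_fun measurableSet_Ioi fun t _ => eint_eq_rpow n r t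
    _ = (1 / r) ^ (((n + 1 : ℕ) : ℝ)) * Real.Gamma ((n + 1 : ℕ) : ℝ) :=
        Real.integral_rpow_mul_exp_neg_mul_Ioi hn hr
    _ = Nat.factorial n * r⁻¹ ^ (n + 1) := by
        rw [Real.rpow_natCast, show (((n + 1 : ℕ) : ℝ)) = (n : ℝ) + 1 by push_cast; ring,
          Real.Gamma_nat_eq_factorial, one_div]
        ring

/-- `e⁻² / r^{n+1} ≤ eul n a r` for `0 < r` and `a ≤ 1/r` (the window `t ∈ (1/r, 2/r]`). -/
theorem eul_ge (n : ℕ) {a r : ℝ} (ha : 0 ≤ a) (hr : 0 < r) (har : a ≤ r⁻¹) :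
    Real.exp (-2) * r⁻¹ ^ (n + 1) ≤ eul n a r := by
  have hsub : Ioc r⁻¹ (2 * r⁻¹) ⊆ Ioi a := fun t ht => mem_Ioi.2 (lt_of_le_of_lt har (mem_Ioc.1 ht).1)
  have hconst : ∀ t ∈ Ioc r⁻¹ (2 * r⁻¹), Real.exp (-2) * r⁻¹ ^ n ≤ eint n r t := by
    intro t ht
    have ht1 : r⁻¹ ≤ t := (mem_Ioc.1 ht).1.le
    have ht0 : 0 ≤ t := le_trans (by positivity) ht1
    have hrt : r * t ≤ 2 := by
      have := mul_le_mul_of_nonneg_left (mem_Ioc.1 ht).2 hr.le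
      rwa [show r * (2 * r⁻¹) = 2 by field_simp] at this
    calc Real.exp (-2) * r⁻¹ ^ n = r⁻¹ ^ n * Real.exp (-2) := mul_comm _ _
      _ ≤ t ^ n * Real.exp (-(r * t)) :=
          mul_le_mul (pow_le_pow_left₀ (by positivity) ht1 n) (Real.exp_le_exp.2 (by linarith))
            (Real.exp_pos _).le (pow_nonneg ht0 n)
  calc Real.exp (-2) * r⁻¹ ^ (n + 1) = (Real.exp (-2) * r⁻¹ ^ n) * (2 * r⁻¹ - r⁻¹) := by ring
    _ = ∫ _ in Ioc r⁻¹ (2 * r⁻¹), Real.exp (-2) * r⁻¹ ^ n := by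
        rw [setIntegral_const, Real.volume_real_Ioc_of_le (by linarith [inv_pos.2 hr]), smul_eq_mul]
        ring
    _ ≤ ∫ t in Ioc r⁻¹ (2 * r⁻¹), eint n r t :=
        setIntegral_mono_on (integrableOn_const (by simp [Real.volume_Ioc]))
          ((integrableOn_eint n ha hr).mono_set hsub) measurableSet_Ioc hconst
    _ ≤ eul n a r :=
        setIntegral_mono_set (integrableOn_eint n ha hr)
          (ae_restrict_of_forall_mem measurableSet_Ioi fun t ht =>
            eint_nonneg n r (ha.trans (le_of_lt ht)))
          (Eventually.of_forall hsub)

/-- `eul n a r ≤ e^{a(1-r)} · eul n a 1` for `r ≥ 1`, `a ≥ 0` (`rt ≥ t + a(r − 1)` for `t ≥ a`). -/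
theorem eul_le_exp (n : ℕ) {a r : ℝ} (ha : 0 ≤ a) (hr : 1 ≤ r) :
    eul n a r ≤ Real.exp (a * (1 - r)) * eul n a 1 := by
  have hpt : ∀ t ∈ Ioi a, eint n r t ≤ Real.exp (a * (1 - r)) * eint n 1 t := by
    intro t ht
    have hta : a ≤ t := le_of_lt ht
    have ht0 : 0 ≤ t := ha.trans hta
    unfold eint
    rw [mul_left_comm, ← Real.exp_add]
    gcongr
    nlinarith
  calc eul n a r ≤ ∫ t in Ioi a, Real.exp (a * (1 - r)) * eint n 1 t :=
        setIntegral_mono_on (integrableOn_eint n ha (by linarith)) ((integrableOn_eint n ha one_pos).const_mul _)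
          measurableSet_Ioi hpt
    _ = Real.exp (a * (1 - r)) * eul n a 1 := by rw [integral_const_mul]; rfl

/-- Auxiliary fact `eint_antitone` of the generalised-free-field witness (see the module docstring). [folklore] -/
theorem eint_antitone (n : ℕ) {r r' : ℝ} (h : r ≤ r') {t : ℝ} (ht : 0 ≤ t) : eint n r' t ≤ eint n r t := by
  unfold eint; gcongr

/-- Auxiliary fact `eul_antitone` of the generalised-free-field witness (see the module docstring). [folklore] -/
theorem eul_antitone (n : ℕ) {a r r' : ℝ} (ha : 0 ≤ a) (hr : 0 < r) (h : r ≤ r') : eul n a r' ≤ eul n a r :=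
  setIntegral_mono_on (integrableOn_eint n ha (hr.trans_le h)) (integrableOn_eint n ha hr) measurableSet_Ioi
    fun _ ht => eint_antitone n h (ha.trans (le_of_lt ht))

end GFF

end Summit.QuantumFields.YangMills.Theorems.CurvatureKernelBound.Negative
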